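import Summits.AtomisticToContinuum.FouriersLaw.Theses.PorousMediumCorner
import Summits.AtomisticToContinuum.FouriersLaw.Theorems.EmbeddedDrudeMourreGreenKuboContinuationCanonicalSpectralMeasure
import HarnessLib

/-!
# BC3 birth skeleton of the piece `AnchorSpectralSetup` (support child of the split of `PorousMediumCorner.AnchorAbelGreenKubo`,
# stmt-AtomisticToContinuum-9790) — the provable-now infrastructure of the anchor at `T = 1`

Seam = the tree's own pipeline for the pinned chain (`MourreDissolution.stub_gibbsClustering` → `symmetricFramework_of_clustering`
→ `GreenKuboContinuation.BandLimitedKrylov.exists_even_spectralMeasure_of_zeroWavenumberData`), instantiated at the purely quartic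
chain `U = μq⁴/4`, `V = r⁴/4`, `T = 1`:

* stub 1 `stub_anchorClusteringState` — for every Buttà–Marchioro normal-form dynamics `D` of the anchor (carrier `𝒳₀ = bmGood`,
  measurable flow, identity off `𝒳₀`) there is a DLR state at `T = 1` which is shift-invariant, superstable, reflection-symmetric,
  with summable space-time clustering of the generator pairs `{j₀, h₀}` and continuity at `0` of the summed autocorrelations
  (anchor twin of `stub_gibbsClustering`, landed for pinnedChain: transfer-operator state, exponential mixing + fixed-time `L²`
  locality ⇒ `ℓ¹` clustering; every ingredient is stated in the tree for a general chain with even polynomial potentials);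
* stub 2 `stub_anchorFrameworkOfClustering` — such a clustering state yields Doyon's zero-wavenumber data `Z` for some normal-form
  `D`, with `Z.μ` DLR at `T = 1`, momentum-reversal symmetry and a strongly continuous Koopman group (anchor twin of
  `symmetricFramework_of_clustering`, landed: `exists_symmetric_bmDynamics` + `exists_zeroWavenumberData_of_clustering`);
* `AnchorSpectralSetup_of` — PROVED from the two stubs by name: shift invariance, `PreservesMeasure`, absolute convergence are the
  `ZeroWavenumberData` API, and the finite (even) spectral measure is `exists_even_spectralMeasure_of_zeroWavenumberData`
  (positive type of `C(t) = ⟪[J], U_t[J]⟫₀` + the cosine Bochner theorem, landed).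

`AnchorSpectralSetup` below is a LOCAL copy of the child's statement (byte-identical with children.json / the registered stub
`stub_anchorSpectralSetup` of `Lines/spectral_trichotomy.lean`). lean check: rc 0, sorries = the two stubs.
-/

noncomputable section

namespace Summit.AtomisticToContinuum.FouriersLaw.Cruxes.AnchorAbelGreenKubo.BirthSpectralSetup

open MeasureTheory Filter Set Topology
open Literature.MathematicalPhysics.KineticTheory.HeatConduction
open scoped ENNReal NNReal

/-- Local copy of the piece (see the module docstring). -/
def AnchorSpectralSetup : Prop :=
  ∀ μ γ : ℝ, 0 < μ → ∃ (ρ : MeasureTheory.Measure Literature.MathematicalPhysics.KineticTheory.HeatConduction.ChainConfig) (D : Literature.MathematicalPhysics.KineticTheory.HeatConduction.InfiniteChainDynamics (Literature.MathematicalPhysics.KineticTheory.HeatConduction.OscillatorChain.mk (fun q => μ * q ^ 4 / 4) (fun r => r ^ 4 / 4) γ)), (Literature.MathematicalPhysics.KineticTheory.HeatConduction.OscillatorChain.mk (fun q => μ * q ^ 4 / 4) (fun r => r ^ 4 / 4) γ).IsChainGibbsMeasure 1 ρ ∧ (∀ x : ℤ, MeasureTheory.MeasurePreserving (fun σ : Literature.MathematicalPhysics.KineticTheory.HeatConduction.ChainConfig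 => fun i : ℤ => σ (i + x)) ρ ρ) ∧ D.PreservesMeasure ρ ∧ (∀ t : ℝ, D.HasAbsConvergentCorrelation ρ t) ∧ ∃ σ : MeasureTheory.Measure ℝ, MeasureTheory.IsFiniteMeasure σ ∧ ∀ t : ℝ, D.currentCorrelation ρ t = MeasureTheory.integral σ (fun ω : ℝ => Real.cos (ω * t))

/-- The clustering-state property of the anchor at `T = 1` (anchor twin of the statement of `stub_gibbsClustering`). -/
def AnchorClusteringState : Prop :=
  ∀ μ γ : ℝ, 0 < μ →
    ∀ D : InfiniteChainDynamics (OscillatorChain.mk (fun q => μ * q ^ 4 / 4) (fun r => r ^ 4 / 4) γ),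
      D.carrier = (OscillatorChain.mk (fun q => μ * q ^ 4 / 4) (fun r => r ^ 4 / 4) γ).bmGood → (∀ t : ℝ, Measurable (D.flow t)) →
      (∀ t : ℝ, ∀ σ ∉ (OscillatorChain.mk (fun q => μ * q ^ 4 / 4) (fun r => r ^ 4 / 4) γ).bmGood, D.flow t σ = σ) →
      ∃ ρ : Measure ChainConfig,
        (OscillatorChain.mk (fun q => μ * q ^ 4 / 4) (fun r => r ^ 4 / 4) γ).IsChainGibbsMeasure 1 ρ ∧ IsShiftInvariant ρ ∧ (OscillatorChain.mk (fun q => μ * q ^ 4 / 4) (fun r => r ^ 4 / 4) γ).HasSuperstabilityEstimate ρ ∧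
        ρ.map (fun (σ : ChainConfig) (x : ℤ) => σ (-x)) = ρ ∧
        (∀ a ∈ ({fun σ => (OscillatorChain.mk (fun q => μ * q ^ 4 / 4) (fun r => r ^ 4 / 4) γ).bondCurrentZ σ 0, fun σ => (OscillatorChain.mk (fun q => μ * q ^ 4 / 4) (fun r => r ^ 4 / 4) γ).energyDensityZ σ 0} : Set (ChainConfig → ℝ)),
          ∀ b ∈ ({fun σ => (OscillatorChain.mk (fun q => μ * q ^ 4 / 4) (fun r => r ^ 4 / 4) γ).bondCurrentZ σ 0, fun σ => (OscillatorChain.mk (fun q => μ * q ^ 4 / 4) (fun r => r ^ 4 / 4) γ).energyDensityZ σ 0} : Set (ChainConfig → ℝ)),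
          ∀ u : ℝ, Summable fun x : ℤ => ProbabilityTheory.covariance a ((b ∘ chainShift x) ∘ D.flow u) ρ) ∧
        (∀ a ∈ ({fun σ => (OscillatorChain.mk (fun q => μ * q ^ 4 / 4) (fun r => r ^ 4 / 4) γ).bondCurrentZ σ 0, fun σ => (OscillatorChain.mk (fun q => μ * q ^ 4 / 4) (fun r => r ^ 4 / 4) γ).energyDensityZ σ 0} : Set (ChainConfig → ℝ)),
          ContinuousAt (fun t : ℝ => ∑' x : ℤ, ProbabilityTheory.covariance a ((a ∘ chainShift x) ∘ D.flow t) ρ) 0)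

/-- The symmetric zero-wavenumber framework of the anchor at `T = 1` (anchor twin of the conclusion of
`symmetricFramework_of_clustering`, trimmed to what the piece consumes). -/
def AnchorSymmetricFramework : Prop :=
  ∀ μ γ : ℝ, 0 < μ →
    ∃ (D : InfiniteChainDynamics (OscillatorChain.mk (fun q => μ * q ^ 4 / 4) (fun r => r ^ 4 / 4) γ)) (Z : ZeroWavenumberData (OscillatorChain.mk (fun q => μ * q ^ 4 / 4) (fun r => r ^ 4 / 4) γ) D),
      (OscillatorChain.mk (fun q => μ * q ^ 4 / 4) (fun r => r ^ 4 / 4) γ).IsChainGibbsMeasure 1 Z.μ ∧ (OscillatorChain.mk (fun q => μ * q ^ 4 / 4) (fun r => r ^ 4 / 4) γ).HasSuperstabilityEstimate Z.μ ∧ Z.HasMomentumReversal ∧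
      (∀ ψ : ZeroWavenumberSpace Z, Continuous fun t : ℝ => Z.koopman t ψ)

/-- **Stub 1 (provable now, L).** The anchor at `T = 1` has a clustering state for every normal-form Buttà–Marchioro dynamics:
transfer-operator Markov state of the purely quartic chain (needs `e^{-μq⁴/4} ∈ L¹`), shift-invariant, superstable,
reflection-symmetric, exponentially mixing; fixed-time `L²` locality of the evolved generators; hence summable space-time
clustering and continuity at `0`. [cite: ButtaMarchioro2016, §2 Thm 2.1] -/
theorem stub_anchorClusteringState : AnchorClusteringState := by
  sorry

/-- **Stub 2 (provable now, M).** A clustering state yields the symmetric zero-wavenumber framework: the symmetric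
Buttà–Marchioro dynamics of the even quartic chain (`exists_symmetric_bmDynamics`-type construction, `s₁ = s₂ = 2`) and
`exists_zeroWavenumberData_of_clustering` with strong continuity from the generators. [cite: Doyon2022, §4.1 Def. 4.3–4.4] -/
theorem stub_anchorFrameworkOfClustering : AnchorClusteringState → AnchorSymmetricFramework := by
  sorry

/-- **`AnchorSpectralSetup_of`** — PROVED from the two stubs by name: the state `Z.μ` is DLR at `1` and shift-invariant
(`Z.measurePreserving_shift`), `D` preserves it with absolutely convergent summed current autocorrelation (`ZeroWavenumberData`
API, zero mean current by momentum reversal), and `C = ⟪[J], U_t[J]⟫₀` is the cosine transform of a finite (even) measure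
(`exists_even_spectralMeasure_of_zeroWavenumberData`: positive type + cosine Bochner, landed). [folklore] -/
theorem AnchorSpectralSetup_of : AnchorSpectralSetup := by
  intro μ γ hμ
  obtain ⟨D, Z, hG, -, hRev, hsc⟩ := stub_anchorFrameworkOfClustering stub_anchorClusteringState μ γ hμ
  have hmean : ∫ σ, (OscillatorChain.mk (fun q => μ * q ^ 4 / 4) (fun r => r ^ 4 / 4) γ).bondCurrentZ σ 0 ∂Z.μ = 0 := Z.integral_bondCurrent_eq_zero hRev
  obtain ⟨σ, hσ, -, hcos⟩ :=
    Summit.AtomisticToContinuum.FouriersLaw.Theorems.GreenKuboContinuation.BandLimitedKrylov.exists_even_spectralMeasure_of_zeroWavenumberData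
      Z hRev hsc
  refine ⟨Z.μ, D, hG, fun x => ?_, Z.preservesMeasure, fun t => Z.hasAbsConvergentCorrelation hmean t, σ, hσ, hcos⟩
  exact Z.measurePreserving_shift x

end Summit.AtomisticToContinuum.FouriersLaw.Cruxes.AnchorAbelGreenKubo.BirthSpectralSetup

end
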